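import Literature.NumberTheory.EllipticCurves.BSDConductorIsEllipticPotGoodTwoProofs
import Literature.NumberTheory.EllipticCurves.PotentialGoodReductionInertiaProofs
import Literature.NumberTheory.EllipticCurves.TateModuleUnipotentInertiaProofs
import Literature.NumberTheory.EllipticCurves.OggFormulaWildTypesKodairaProofs
import Literature.NumberTheory.DiophantineGeometry.ConductorExponentLeEightProofs
import Literature.NumberTheory.DiophantineGeometry.LocalReductionFiniteBadPlacesProofs
import Literature.NumberTheory.DiophantineGeometry.LocalReductionProofs
import Literature.NumberTheory.DiophantineGeometry.MinimalDiscriminantSpanProofs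
import Mathlib.NumberTheory.RamificationInertia.Valuation
import HarnessLib

/-!
# Ogg's formula at `2` for the Kodaira types `IV` and `IV*` over `ℚ` (the tame potentially good
# curves: `Sw_𝔓(E[ℓ]) = 0 = δ₂`)

`Proofs` file (theorems only, no definitions, no named facts, no instances) in topic
`NumberTheory/EllipticCurves`, landed by the seat of the C15 fact
`WeierstrassCurve.conductorNatOf_geomPoints_eq_conductorNorm_of_isElliptic W ℓ` (`HasseWeilAbelian`;
Serre–Tate 1968 §3 with Silverman, *Advanced Topics in the Arithmetic of Elliptic Curves*, §IV.10
and Ogg's formula IV.11.1).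

## Context

After `HasseWeilAbelianConductorNatOfPotGoodTwoProofs`, `OggFormulaPotMultTwoProofs` (`ord₂(j) < 0`)
and `OggFormulaPotGoodOrdinaryTwoProofs` (`ord₂(j) = 0`), the three conductor facts over `ℚ`
(`conductorNatOf_geomPoints_eq_conductorNorm_of_isElliptic`, `conductorNorm_eq_artinConductorNat_of_isElliptic`,
`conductor_eq_conductorOf_mul_of_isElliptic`) rest on one statement about one curve over `ℚ₂`:
*if `E/ℚ` is additive at `2` with `ord₂(j) > 0` (potentially good, supersingular special fibre of
the potential good model), then `Sw_𝔓(E[3]) = δ₂(E) := (ord₂ Δ_min + 1 - m₂) - 2`* — the case of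
Saito's theorem (Ogg's formula IV.11.1 in mixed characteristic `(0, 2)`; Saito 1988, Thm. 1;
*ATAEC* p. 366: *"A similar proof for `p = 2` would be extremely lengthy"*) with no printed
case-by-case verification.  In that case the inertia group acts on `E[3]` through a subgroup
`Φ ≤ Aut(Ẽ) ≅ SL₂(𝔽₃)` of order `2, 3, 4, 6, 8` or `24` (Serre–Tate; Kraus 1990), and the statement
splits along the branches of Tate's algorithm at `2` (`ConductorExponentLeEightProofs`:
`II: ord₂Δ ∈ {4,6,7}`, `III: {4,6,8,9}`, `IV: {4}`, `I₀*: {8,9,10}`, `Iₙ*: n + {7,…,11}`,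
`IV*: {8}`, `III*: {10,12,14,15}`, `II*: {11,12,14}`).

This file proves the **tame branches**, Kodaira types **`IV`** and **`IV*`** at `2` — the curves
with `Φ = C₃`, `δ₂ = 0` — for *every* elliptic curve over `ℚ` of these types (any `j`), every
prime `ℓ ≠ 2` and every prime `𝔓 ∣ 2` of `\bar ℤ`:

  `Sw_𝔓(V_ℓ E) = Sw_𝔓(E[ℓ]) = 0 = δ₂(E)`.

## The argument

* **Discriminant side** (§2; *ATAEC* IV.9.4 Steps 5 and 8 with `π = 2`).  A minimal equation of
  type `IV` at `2` has an `ℤ₂`-model with `2 ∣ a₁, a₂`, `a₃ ∈ 2ℤ₂^×`, `4 ∣ a₄, a₆`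
  (`LocalIndex.exists_smul_of_kodairaSymbolOfMinimal_eq_IV`), whence `ord₂ Δ_min = 4`
  (`CharTwo.addVal_Δ_toNat_eq_four_of_step5`) and `δ₂ = ord₂ Δ_min - 4 = 0`; type `IV*` has
  `2 ∣ a₁`, `4 ∣ a₂`, `a₃ ∈ 4ℤ₂^×`, `8 ∣ a₄`, `16 ∣ a₆`, `ord₂ Δ_min = 8`, `δ₂ = ord₂ Δ_min - 8 = 0`
  (`…_eq_IVstar`, `CharTwo.isUnit_of_distinctRootCount_quadraticStep8_eq_two`,
  `CharTwo.addVal_Δ_toNat_eq_eight_of_step8`).  By density of `ℚ` in `ℚ₂` the same shapes hold on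
  a `ℚ`-model `C • E` (`exists_variableChange_valuation_a_of_two`; the coefficients of `C • E` are
  polynomial in `(u⁻¹, r, s, t)`, cf. `LocalReduction.isMinimalAt_iff_isMinimal_integer_holds`).
* **Good reduction over `ℚ(∛2)`** (§3).  Over any number field `L ∋ β` with `β³ = 2` the
  substitution `(x, y) ↦ (β²x, β³y)` (type `IV`), resp. `(β⁴x, β⁶y)` (type `IV*`), of that
  `ℚ`-model is integral with unit discriminant at every place `w ∣ 2` of `L`
  (`hasGoodReductionAt_baseChange_of_pow_three_eq`: if `w(β) = ϖ^l`, `w(2) = ϖ^e` then `3l = e`,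
  and `ord_w(aᵢ/β^{ij}) = e·ord₂(aᵢ) - ijl ≥ l(3kᵢ - ij) ≥ 0`, `ord_w(Δ/β^{12j}) = l(3n - 12j) = 0`):
  **`E` acquires good reduction over the tamely ramified extension `ℚ₂(∛2)`** — the reduced curve
  `y² + a₃' y = x³ + a₂'x² + a₄'x + a₆'` (`a₃' = a₃/2 ∈ 𝔽₂^×`) is the supersingular curve `j = 0`.
* **Galois side** (§1, Kummer theory at a tame prime).  For `u > 0` the ramification group
  `Γ_K^u(𝔓)` (`𝔓 ∣ v ∋ 2`) maps into `Gal(F/K)^u ≤ G₁(F/K)`, a `2`-group, for the splitting field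
  `F` of `X³ - a` (`isPGroup_ramificationSubgroup_one_of_mem_primesAbove`,
  `upperRamificationSubgroup_le_ramificationSubgroup_one`); for `σ ∈ Γ_K^u(𝔓)` and `β³ = a ≠ 0`
  the quotient `ζ = σβ/β` is a cube root of unity, fixed by the inertia group (`(ζ₁ - ζ₂)² = -3ζ₁ζ₂`
  and `3 ∉ 𝔓`, `smul_eq_of_mem_inertia_of_pow_three_eq_one`), so `σ^k β = ζ^k β`; as
  `σ^{2^t}|_F = 1`, `ζ^{2^t} = 1 = ζ³` and `ζ = 1`: **`Γ_K^u(𝔓)` fixes every cube root of every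
  `a ∈ K`** (`smul_eq_of_mem_absUpperRamificationSubgroup_of_pow_three_eq`).  Hence every
  `σ ∈ Γ_ℚ^u(𝔓)`, `u > 0`, lies in the image of `Γ_{ℚ(∛2)}` and, `E` having good reduction over
  `ℚ(∛2)` above `2`, fixes the prime-to-`2` torsion (*AEC* VII.4.1(a) over `ℚ(∛2)`,
  `smul_eq_of_mem_inertia_of_baseChange_of_nsmul_eq_zero`, `PotentialGoodReductionInertiaProofs`):
  the wild ramification groups above `2` fix `E[ℓ]`, and `Sw_𝔓(V_ℓ E) = 2·vol ∅ = 0`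
  (`swanConductorAt_rationalTate_eq_zero_of_forall_smul_geomTorsion_eq`).

## Main results (all over `ℚ`, `v ∋ 2`, `W` elliptic of Kodaira type `IV` or `IV*` at `v`)

* `WeierstrassCurve.ordMinimalDiscriminant_eq_of_kodairaSymbolAt_IV_two / _IVstar_two`,
  `WeierstrassCurve.wildConductorExponent_eq_zero_of_kodairaSymbolAt_IV_or_IVstar_two` — `ord₂ Δ_min = 4`,
  resp. `8`, and `δ₂ = 0`;
* `WeierstrassCurve.hasGoodReductionAt_baseChange_of_kodairaSymbolAt_IV_or_IVstar_two` — good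
  reduction above `2` over any number field containing a cube root of `2`;
* `WeierstrassCurve.forall_smul_geomTorsion_eq_of_kodairaSymbolAt_IV_or_IVstar_two` — every
  `Γ_ℚ^u(𝔓)`, `u > 0`, `𝔓 ∣ 2`, fixes `E[ℓ]` (`ℓ` odd prime);
* `WeierstrassCurve.swanConductorAt_rationalTate_eq_zero_of_kodairaSymbolAt_IV_or_IVstar_two`,
  `WeierstrassCurve.swanConductorAt_torsion_eq_wildConductorExponent_of_kodairaSymbolAt_IV_or_IVstar_two`
  — **`Sw_𝔓(V_ℓ E) = 0`** and **`Sw_𝔓(E[3]) = δ₂(E)`** (both sides `0`), i.e. the remaining leaf of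
  Ogg–Saito over `ℚ` for these curves, in the exact shape of the hypothesis `H` of
  `conductorNatOf_geomPoints_eq_conductorNorm_of_isElliptic_of_potentiallyGood`;
* the four conductor facts for such `W` and every prime `ℓ`, unconditionally:
  `conductorNatOf_geomPoints_eq_conductorNorm_of_isElliptic_of_kodairaSymbolAt_IV_or_IVstar_two`,
  `artinConductorExponent_tate_eq_conductorExponent_of_isElliptic_of_kodairaSymbolAt_IV_or_IVstar_two`,
  `Literature.NumberTheory.EllipticCurves.conductorNorm_eq_artinConductorNat_of_isElliptic_of_kodairaSymbolAt_IV_or_IVstar_two`,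
  `Literature.NumberTheory.EllipticCurves.conductor_eq_conductorOf_mul_of_isElliptic_of_kodairaSymbolAt_IV_or_IVstar_two`.

What remains of Saito's theorem over `ℚ` after this file and its siblings: the additive curves at
`2` with `ord₂(j) > 0` of the **wild** Kodaira types `II, III, I₀*, Iₙ* (n ≥ 1), III*, II*`
(`δ₂ ∈ {1, …, 6}`, `Φ` of even order).

No definitions, no named facts (D-0026).  All axioms `propext`, `Classical.choice`, `Quot.sound`.

## References

* J. H. Silverman, *Advanced Topics in the Arithmetic of Elliptic Curves*, GTM 151 (1994), IV.9.4
  (Tate's algorithm, Steps 5 and 8) and Table 4.1; §IV.10 (Definition of `ε, δ, f`, PDF p. 358;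
  Thm. 10.2(b) and Prop. 10.3: good reduction over `K(E[m])`, pp. 359–361); §IV.11 (Ogg's formula
  11.1, p. 365; the case `p = 2`, p. 366). [SilvermanATAEC1994]
* J. H. Silverman, *The Arithmetic of Elliptic Curves*, 2nd ed. (2009), VII.1 (minimal equations,
  Remark 1.1), VII.4.1(a), VII.5 Prop. 5.1(a) and Prop. 5.4 (semistable reduction). [SilvermanAEC2009]
* J.-P. Serre, J. Tate, *Good reduction of abelian varieties*, Ann. of Math. 88 (1968), §2
  Cor. 2–3 (potential good reduction; the inertia group acts through a finite quotient), §3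
  (the conductor). [SerreTate1968]
* J.-P. Serre, *Local Fields*, GTM 67 (1979), Ch. IV §1 Prop. 2, §2 Cor. 3 of Prop. 7 (`G₁` is a
  `p`-group, `G₀/G₁` has order prime to `p`), §3 Prop. 14 and Remark 1; Ch. VI §2 (the Swan
  conductor). [SerreLocalFields1979]
* A. Kraus, *Sur le défaut de semi-stabilité des courbes elliptiques à réduction additive*,
  Manuscripta Math. 69 (1990), 353–385 (the inertia image `Φ` at `p = 2`; cited for context only).
* T. Saito, *Conductor, discriminant, and the Noether formula of arithmetic surfaces*, Duke Math.
  J. 57 (1988), 151–173, Theorem 1 (cited only). [Saito1988]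

## Design

Theorems only; `noncomputable section`; one universe `u`.  §1 in
`namespace Literature.NumberTheory.GaloisRepresentations` (number-field level, any `K`); §2 in
`namespace Literature.NumberTheory.EllipticCurves.LocalIndex` (DVR level, as the normal forms of
`NeronComponentIndexTypeIV*Proofs`) and `namespace WeierstrassCurve` (places of Dedekind domains,
signatures of `OggFormulaWildTypesKodairaProofs.exists_variableChange_b_of_exists_smul_localMinimalIntegralModel`);
§3 for any extension of number fields; §4 over `ℚ` (`v ∋ 2`, so that the statements apply verbatim
to `v₂ = primesEquiv.symm 2` of the `H`-hypotheses).  Axioms: `propext`, `Classical.choice`,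
`Quot.sound`.
-/

noncomputable section

open scoped Classical NumberField Polynomial IntermediateField
open NumberField IsDedekindDomain Field Polynomial WithZero

universe u

/-! ## §1. Kummer theory at a tame prime: `Γ_K^u(𝔓)`, `u > 0`, fixes the cube roots -/

namespace Literature.NumberTheory.GaloisRepresentations

open Literature.NumberTheory.EllipticCurves

variable {K : Type u} [Field K] [NumberField K]

omit [NumberField K] in
/-- **The inertia group fixes the cube roots of unity** at a prime `𝔓 ∣ v ∌ 3`.  For `σ ∈ I_𝔓`
and `ζ ∈ K̄` with `ζ³ = 1`: `ζ` is an algebraic integer and `σζ - ζ ∈ 𝔓`; if `σζ ≠ ζ` then, both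
being cube roots of unity, `(σζ)² + σζ·ζ + ζ² = 0`, so `(σζ - ζ)² = -3·σζ·ζ ∈ 𝔓` with `σζ·ζ` a
unit, forcing `3 ∈ 𝔓 ∩ 𝓞 K = v` — excluded.  (Equivalently: `μ₃` injects into the residue field
in residue characteristic `≠ 3`.)  Serre, *Local Fields*, Ch. IV §2, Cor. 1 of Prop. 7 ff.
[cite: SerreLocalFields1979, Ch. IV §2] -/
theorem smul_eq_of_mem_inertia_of_pow_three_eq_one
    {v : HeightOneSpectrum (𝓞 K)} (h3 : (3 : 𝓞 K) ∉ v.asIdeal)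
    {𝔓 : Ideal (absIntegers (𝓞 K) K)} (h𝔓 : 𝔓 ∈ v.primesAbove)
    {σ : absoluteGaloisGroup K} (hσ : σ ∈ 𝔓.inertia (absoluteGaloisGroup K))
    {ζ : AlgebraicClosure K} (hζ : ζ ^ 3 = 1) : σ • ζ = ζ := by
  haveI : 𝔓.IsPrime := h𝔓.1
  -- `ζ` is an algebraic integer
  have hζint : IsIntegral (𝓞 K) ζ := by
    refine ⟨X ^ 3 - 1, (monic_X_pow _).sub_of_left (by rw [degree_one, degree_X_pow]; norm_num), ?_⟩
    simp [hζ]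
  set z : absIntegers (𝓞 K) K := ⟨ζ, hζint⟩ with hz
  have hz3 : z ^ 3 = 1 := Subtype.ext (by simp [hz, hζ])
  have hσz3 : (σ • z) ^ 3 = 1 := by rw [← smul_pow', hz3, smul_one]
  have hmem : σ • z - z ∈ 𝔓 := hσ z
  by_contra hne
  have hne' : σ • z ≠ z := by
    intro h
    apply hne
    have := congrArg (fun t : absIntegers (𝓞 K) K ↦ (t : AlgebraicClosure K)) h
    simpa [integralClosure.coe_smul, hz] using this
  -- `(σz)² + σz·z + z² = 0`
  have hsum : (σ • z) ^ 2 + (σ • z) * z + z ^ 2 = 0 := by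
    have h0 : (σ • z - z) * ((σ • z) ^ 2 + (σ • z) * z + z ^ 2) = 0 := by
      have : (σ • z - z) * ((σ • z) ^ 2 + (σ • z) * z + z ^ 2) = (σ • z) ^ 3 - z ^ 3 := by ring
      rw [this, hσz3, hz3, sub_self]
    exact (mul_eq_zero.mp h0).resolve_left (sub_ne_zero.mpr hne')
  -- `(σz - z)² = -3·(σz·z) ∈ 𝔓`
  have hsq : (σ • z - z) ^ 2 = -(3 * ((σ • z) * z)) := by linear_combination hsum
  have h3mem : (3 : absIntegers (𝓞 K) K) * ((σ • z) * z) ∈ 𝔓 := by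
    rw [← neg_mem_iff, ← hsq, pow_two]
    exact Ideal.mul_mem_left _ _ hmem
  -- `σz·z` is a unit: `(σz·z)·((σz)²z²) = 1`
  have hunit : IsUnit ((σ • z) * z) := by
    refine IsUnit.of_mul_eq_one ((σ • z) ^ 2 * z ^ 2) ?_
    have : (σ • z) * z * ((σ • z) ^ 2 * z ^ 2) = (σ • z) ^ 3 * z ^ 3 := by ring
    rw [this, hσz3, hz3, one_mul]
  have hnot : ¬ ((σ • z) * z ∈ 𝔓) := fun h ↦
    Ideal.IsPrime.ne_top' (Ideal.eq_top_of_isUnit_mem 𝔓 h hunit)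
  have h3𝔓 : (3 : absIntegers (𝓞 K) K) ∈ 𝔓 :=
    (Ideal.IsPrime.mem_or_mem inferInstance h3mem).resolve_right hnot
  apply h3
  rw [h𝔓.2.over]
  change (3 : 𝓞 K) ∈ Ideal.comap (algebraMap (𝓞 K) (absIntegers (𝓞 K) K)) 𝔓
  rw [Ideal.mem_comap, map_ofNat]
  exact h3𝔓

/-- **The wild ramification groups above `2` fix the cube roots** (Kummer theory at a tame prime).
Let `K` be a number field, `v ∋ 2` a finite place, `𝔓 ∣ v` a prime of `\bar ℤ_K`, `u > 0`,
`σ ∈ Γ_K^u(𝔓)`, and `β ∈ K̄` with `β³ = a ∈ K^×`.  Then `σβ = β`.  Proof: let `F ⊆ K̄` be the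
splitting field of `X³ - a` (finite Galois); the restriction of `σ` lies in
`Gal(F/K)^u ≤ G₁(F/K)` (`mem_absUpperRamificationSubgroup_iff`,
`upperRamificationSubgroup_le_ramificationSubgroup_one`), a `2`-group
(`isPGroup_ramificationSubgroup_one_of_mem_primesAbove`), so `σ^{2^t}` fixes `F ∋ β` for some `t`.
On the other hand `ζ = σβ/β` satisfies `ζ³ = 1`, hence is fixed by `σ ∈ I_𝔓`
(`smul_eq_of_mem_inertia_of_pow_three_eq_one`, `3 ∉ v` as `2 ∈ v`), so `σ^k β = ζ^k β` for all
`k`; thus `ζ^{2^t} = 1 = ζ³` and `ζ = ζ^{gcd(2^t, 3)} = 1`.  (The tame quotient `I/P` acts on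
`∛a` through `μ₃`, of order prime to `2`: Serre, *Local Fields*, Ch. IV §2, Cor. 1–3 of Prop. 7.)
[cite: SerreLocalFields1979, Ch. IV §2 Cor. 1–3 of Prop. 7 and §3 Remark 1] -/
theorem smul_eq_of_mem_absUpperRamificationSubgroup_of_pow_three_eq
    {v : HeightOneSpectrum (𝓞 K)} (h2 : (2 : 𝓞 K) ∈ v.asIdeal)
    {𝔓 : Ideal (absIntegers (𝓞 K) K)} (h𝔓 : 𝔓 ∈ v.primesAbove)
    {u : ℝ} (hu : 0 < u) {σ : absoluteGaloisGroup K}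
    (hσ : σ ∈ absUpperRamificationSubgroup (𝓞 K) 𝔓 u)
    {a : K} (ha : a ≠ 0) {β : AlgebraicClosure K} (hβ : β ^ 3 = algebraMap K _ a) :
    σ • β = β := by
  have h3 : (3 : 𝓞 K) ∉ v.asIdeal := by
    intro h3
    apply (Ideal.ne_top_iff_one v.asIdeal).mp v.isPrime.ne_top
    have := v.asIdeal.sub_mem h3 h2
    rwa [show (3 : 𝓞 K) - 2 = 1 by norm_num] at this
  have hchar : ringChar (𝓞 K ⧸ v.asIdeal) = 2 := by
    haveI : Nontrivial (𝓞 K ⧸ v.asIdeal) := Ideal.Quotient.nontrivial_iff.mpr v.isPrime.ne_top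
    apply CharP.ringChar_of_prime_eq_zero Nat.prime_two
    rw [← map_natCast (Ideal.Quotient.mk v.asIdeal) 2, Ideal.Quotient.eq_zero_iff_mem]
    simpa using h2
  -- the splitting field of `X³ - a` inside `K̄`
  set p : K[X] := X ^ 3 - C a with hp_def
  have hp0 : p ≠ 0 := by
    rw [hp_def]; exact X_pow_sub_C_ne_zero (by norm_num) a
  set F : IntermediateField K (AlgebraicClosure K) :=
    IntermediateField.adjoin K (p.rootSet (AlgebraicClosure K)) with hF_def
  haveI hsplit : p.IsSplittingField K F :=
    IntermediateField.adjoin_rootSet_isSplittingField (IsAlgClosed.splits _)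
  haveI : FiniteDimensional K F := Polynomial.IsSplittingField.finiteDimensional F p
  haveI : Normal K F := Normal.of_isSplittingField p
  haveI : IsGalois K F := IsGalois.mk
  have hβF : β ∈ F := by
    apply IntermediateField.subset_adjoin
    rw [mem_rootSet]
    exact ⟨hp0, by simp [hp_def, hβ]⟩
  -- the restriction of `σ` to `F` lies in `G₁`, a `2`-group
  have hσ1 : absRestrictNormalHom F σ ∈
      (𝔓.comap (F.integralClosureToAbsIntegers (𝓞 K))).ramificationSubgroup (F ≃ₐ[K] F) 1 :=
    upperRamificationSubgroup_le_ramificationSubgroup_one _ _ hu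
      ((mem_absUpperRamificationSubgroup_iff.mp hσ) F)
  obtain ⟨t, ht⟩ := isPGroup_ramificationSubgroup_one_of_mem_primesAbove h𝔓 F ⟨_, hσ1⟩
  rw [hchar] at ht
  have hres : ∀ (τ : absoluteGaloisGroup K) (y : F),
      ((absRestrictNormalHom F τ y : F) : AlgebraicClosure K) = τ • (y : AlgebraicClosure K) :=
    fun τ y ↦ AlgEquiv.restrictNormal_commutes (absoluteGaloisGroup.toAlgEquiv K τ) F y
  have hfix : σ ^ (2 ^ t) • β = β := by
    have h1 := congrArg (fun g : ↥((𝔓.comap (F.integralClosureToAbsIntegers (𝓞 K))).ramificationSubgroup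
        (F ≃ₐ[K] F) 1) ↦ (((g : F ≃ₐ[K] F) ⟨β, hβF⟩ : F) : AlgebraicClosure K)) ht
    simp only [SubmonoidClass.mk_pow, Subgroup.coe_one, AlgEquiv.one_apply] at h1
    rw [← map_pow, hres] at h1
    exact h1
  -- `σ ∈ I_𝔓`, `β ≠ 0`, and `ζ = σβ/β` is a cube root of unity fixed by `σ`
  have hσI : σ ∈ 𝔓.inertia (absoluteGaloisGroup K) :=
    absUpperRamificationSubgroup_le_inertia_holds (𝓞 K) 𝔓 u hσ
  have ha' : algebraMap K (AlgebraicClosure K) a ≠ 0 := by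
    rwa [map_ne_zero_iff _ (algebraMap K (AlgebraicClosure K)).injective]
  have hβ0 : β ≠ 0 := by
    rintro rfl
    rw [zero_pow three_ne_zero] at hβ
    exact ha' hβ.symm
  set ζ : AlgebraicClosure K := σ • β / β with hζ_def
  have hζ3 : ζ ^ 3 = 1 := by
    rw [hζ_def, div_pow, ← smul_pow', hβ, smul_algebraMap, div_self ha']
  have hσζ : σ • ζ = ζ := smul_eq_of_mem_inertia_of_pow_three_eq_one h3 h𝔓 hσI hζ3
  have hσβ : σ • β = ζ * β := by rw [hζ_def, div_mul_cancel₀ _ hβ0]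
  have hσζk : ∀ k : ℕ, σ • ζ ^ k = ζ ^ k := fun k ↦ by rw [smul_pow', hσζ]
  have hiter : ∀ k : ℕ, σ ^ k • β = ζ ^ k * β := by
    intro k
    induction k with
    | zero => simp
    | succ k ih => rw [pow_succ', mul_smul, ih, smul_mul', hσβ, hσζk, pow_succ]; ring
  have h2t : ζ ^ (2 ^ t) = 1 := by
    have := hiter (2 ^ t)
    rw [hfix] at this
    exact (mul_eq_right₀ hβ0).mp this.symm
  have hone : ζ = 1 := by
    have hg : ζ ^ (2 ^ t).gcd 3 = 1 := pow_gcd_eq_one.mpr ⟨h2t, hζ3⟩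
    have hcop : (2 ^ t).gcd 3 = 1 := (Nat.Coprime.pow_left t (by norm_num : Nat.Coprime 2 3))
    rwa [hcop, pow_one] at hg
  rw [hσβ, hone, one_mul]

end Literature.NumberTheory.GaloisRepresentations

/-! ## §2. The discriminant side: the shapes of types `IV`, `IV*` when `2` is a uniformiser -/

namespace Literature.NumberTheory.EllipticCurves

namespace LocalIndex

open IsLocalRing Literature.NumberTheory.DiophantineGeometry
  Literature.NumberTheory.DiophantineGeometry.TateAlgorithm
  Literature.NumberTheory.DiophantineGeometry.TateAlgorithm.CharTwo
open IsDiscreteValuationRing hiding maximalIdeal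

variable {R : Type*} [CommRing R] [IsDomain R] [IsDiscreteValuationRing R]

/-- **Type `IV` when `2` is a uniformiser: `2 ∣ a₁, a₂`, `a₃ ∈ 2R^×`, `4 ∣ a₄, a₆`, `ord Δ = 4`.**
The normal form of Step 5 (`exists_smul_of_kodairaSymbolOfMinimal_eq_IV`: `a₁, a₂, a₃ ∈ 𝔪`,
`a₄, a₆ ∈ 𝔪²`, `b₆ ∉ 𝔪³`) read with `𝔪 = 2R`: `b₆ = a₃² + 4a₆ ≡ a₃² (mod 8)`, so `a₃/2` is a unit,
and `ord Δ = 4` (`CharTwo.addVal_Δ_toNat_eq_four_of_step5`).  Silverman, *ATAEC*, IV.9.4 Step 5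
(and Table 4.1: over `ℚ₂` type `IV` has `f = 2`, `ord Δ = 4`).
[cite: SilvermanATAEC1994, IV.9.4 Step 5] -/
theorem exists_smul_a_of_kodairaSymbolOfMinimal_eq_IV_of_two [PerfectField (ResidueField R)]
    (h2 : Irreducible (2 : R)) (V : WeierstrassCurve R) (hV : V.kodairaSymbolOfMinimal = .IV) :
    ∃ D : WeierstrassCurve.VariableChange R,
      2 ∣ (D • V).a₁ ∧ 2 ∣ (D • V).a₂ ∧ (∃ γ : R, IsUnit γ ∧ (D • V).a₃ = 2 * γ) ∧
      2 ^ 2 ∣ (D • V).a₄ ∧ 2 ^ 2 ∣ (D • V).a₆ ∧ (addVal R (D • V).Δ).toNat = 4 := by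
  obtain ⟨D, h₁, h₂, h₃, h₄, h₆, hb₆⟩ := exists_smul_of_kodairaSymbolOfMinimal_eq_IV V hV
  have hm : ∀ {x : R}, x ∈ maximalIdeal R ↔ (2 : R) ∣ x := fun {x} ↦
    mem_maximalIdeal_iff_dvd_of_irreducible h2 x
  have hmn : ∀ {x : R} {n : ℕ}, x ∈ maximalIdeal R ^ n ↔ (2 : R) ^ n ∣ x := fun {x n} ↦
    mem_maximalIdeal_pow_iff_dvd_of_irreducible h2 x n
  rw [hm] at h₁ h₂ h₃
  rw [hmn] at h₄ h₆ hb₆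
  obtain ⟨γ, hγ⟩ := h₃
  have hγu : IsUnit γ := by
    rw [isUnit_iff_not_dvd h2]
    rintro ⟨γ₁, hγ₁⟩
    obtain ⟨r₁, hr₁⟩ := h₆
    apply hb₆
    exact ⟨2 * γ₁ ^ 2 + 2 * r₁, by rw [WeierstrassCurve.b₆, hγ, hγ₁, hr₁]; ring⟩
  exact ⟨D, h₁, h₂, ⟨γ, hγu, hγ⟩, h₄, h₆,
    addVal_Δ_toNat_eq_four_of_step5 h2 (D • V) h₁ ⟨γ, hγ⟩ (dvd_trans ⟨2, by ring⟩ h₄) h₆ hb₆⟩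

/-- **Type `IV*` when `2` is a uniformiser: `2 ∣ a₁`, `4 ∣ a₂`, `a₃ ∈ 4R^×`, `8 ∣ a₄`, `16 ∣ a₆`,
`ord Δ = 8`.**  The normal form of Step 8 (`exists_smul_of_kodairaSymbolOfMinimal_eq_IVstar`) read
with `𝔪 = 2R`; the Step-8 quadratic `Y² + a₃,₂Y - a₆,₄` has distinct roots in characteristic `2`
iff `a₃,₂ ≠ 0` (`CharTwo.isUnit_of_distinctRootCount_quadraticStep8_eq_two`), and then `ord Δ = 8`
(`CharTwo.addVal_Δ_toNat_eq_eight_of_step8`).  Silverman, *ATAEC*, IV.9.4 Step 8 (Table 4.1: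
over `ℚ₂` type `IV*` has `f = 2`, `ord Δ = 8`). [cite: SilvermanATAEC1994, IV.9.4 Step 8] -/
theorem exists_smul_a_of_kodairaSymbolOfMinimal_eq_IVstar_of_two [PerfectField (ResidueField R)]
    (h2 : Irreducible (2 : R)) (V : WeierstrassCurve R) (hV : V.kodairaSymbolOfMinimal = .IVstar) :
    ∃ D : WeierstrassCurve.VariableChange R,
      2 ∣ (D • V).a₁ ∧ 2 ^ 2 ∣ (D • V).a₂ ∧ (∃ γ : R, IsUnit γ ∧ (D • V).a₃ = 2 ^ 2 * γ) ∧
      2 ^ 3 ∣ (D • V).a₄ ∧ 2 ^ 4 ∣ (D • V).a₆ ∧ (addVal R (D • V).Δ).toNat = 8 := by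
  obtain ⟨D, h₁, h₂, h₃, h₄, h₆, h8⟩ := exists_smul_of_kodairaSymbolOfMinimal_eq_IVstar V hV
  have hm : ∀ {x : R}, x ∈ maximalIdeal R ↔ (2 : R) ∣ x := fun {x} ↦
    mem_maximalIdeal_iff_dvd_of_irreducible h2 x
  have hmn : ∀ {x : R} {n : ℕ}, x ∈ maximalIdeal R ^ n ↔ (2 : R) ^ n ∣ x := fun {x n} ↦
    mem_maximalIdeal_pow_iff_dvd_of_irreducible h2 x n
  rw [hm] at h₁
  rw [hmn] at h₂ h₃ h₄ h₆
  obtain ⟨γ, hγ⟩ := h₃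
  obtain ⟨r, hr⟩ := h₆
  have hγu : IsUnit γ := isUnit_of_distinctRootCount_quadraticStep8_eq_two h2 hγ hr h8
  exact ⟨D, h₁, h₂, ⟨γ, hγu, hγ⟩, h₄, ⟨r, hr⟩,
    addVal_Δ_toNat_eq_eight_of_step8 h2 (D • V) h₁ h₂ hγ hγu h₄ ⟨r, hr⟩⟩

end LocalIndex

end Literature.NumberTheory.EllipticCurves

namespace WeierstrassCurve

open Literature.NumberTheory.EllipticCurves Literature.NumberTheory.DiophantineGeometry
  Literature.NumberTheory.DiophantineGeometry.TateAlgorithm Literature.NumberTheory.GaloisRepresentations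
  IsDedekindDomain.HeightOneSpectrum
open IsDiscreteValuationRing hiding maximalIdeal

section Dedekind

variable {A : Type*} [CommRing A] [IsDedekindDomain A] {K' : Type*} [Field K'] [Algebra A K']
  [IsFractionRing A K'] (v : HeightOneSpectrum A) (X : WeierstrassCurve K')

/-- At a finite place: `{y | v(y) ≤ ϖᵏ}` is a neighbourhood in `K_v` of each of its points
(ultrametric inequality). [folklore] -/
theorem setOf_valued_le_exp_mem_nhds (k : ℕ) {x : v.adicCompletion K'}
    (hx : Valued.v x ≤ exp (-(k : ℤ))) :
    {y : v.adicCompletion K' | Valued.v y ≤ exp (-(k : ℤ))} ∈ nhds x := by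
  obtain ⟨π, hπ⟩ := v.valuation_exists_uniformizer K'
  have hz : Valued.v ((algebraMap K' (v.adicCompletion K') π) ^ k) = exp (-(k : ℤ)) := by
    rw [Valuation.map_pow, valued_algebraMap_adicCompletion, hπ, ← exp_nsmul, nsmul_eq_mul, mul_neg,
      mul_one]
  rw [Valued.mem_nhds]
  by_cases hx0 : Valued.v x = 0
  · have hz0 : Valued.v.restrict ((algebraMap K' (v.adicCompletion K') π) ^ k) ≠ 0 := by
      rw [Ne, Valuation.restrict_eq_zero_iff, hz]; exact exp_ne_zero
    refine ⟨Units.mk0 _ hz0, fun y hy ↦ ?_⟩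
    rw [Units.val_mk0] at hy
    simp only [Set.mem_setOf_eq] at hy ⊢
    have hy' := Valued.v.restrict_lt_iff.mp hy
    rw [map_eq_zero] at hx0
    rw [hx0, sub_zero, hz] at hy'
    exact hy'.le
  · have hx0' : Valued.v.restrict x ≠ 0 := by rwa [Ne, Valuation.restrict_eq_zero_iff]
    refine ⟨Units.mk0 _ hx0', fun y hy ↦ ?_⟩
    rw [Units.val_mk0] at hy
    simp only [Set.mem_setOf_eq] at hy ⊢
    rw [Valuation.map_eq_of_sub_lt _ (Valued.v.restrict_lt_iff.mp hy)]
    exact hx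

/-- If `ord_v(2) = 1` in `K` then `2` is a uniformiser (an irreducible element) of `𝒪_v`
(`irreducible_adicCompletionIntegers_of_valued_eq`). [folklore] -/
theorem irreducible_two_adicCompletionIntegers (h2 : v.valuation K' (2 : K') = exp (-1 : ℤ)) :
    Irreducible (2 : v.adicCompletionIntegers K') := by
  refine irreducible_adicCompletionIntegers_of_valued_eq v 2 ?_
  have : ((2 : v.adicCompletionIntegers K') : v.adicCompletion K') =
      algebraMap K' (v.adicCompletion K') 2 := by rw [map_ofNat]; rfl
  rw [this, valued_algebraMap_adicCompletion, h2]

/-- **From an `𝒪_v`-model with `2`-power shapes to a `K`-model** (`ord_v(2) = 1`).  If some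
`𝒪_v`-change of variables of the integral local minimal model `M` of `X` at `v` has
`2^{k₁} ∣ a₁`, `2^{k₂} ∣ a₂`, `a₃ = 2^{k₃}·unit`, `2^{k₄} ∣ a₄`, `2^{k₆} ∣ a₆` and `ord Δ = n`, then
`ord_v(Δ_min) = n` (the change of variables is `𝒪_v`-integral with unit `u`), and some change of
variables **over `K`** gives a model `C • X` with `ord_v(a₁) ≥ k₁`, `ord_v(a₂) ≥ k₂`,
`ord_v(a₃) = k₃`, `ord_v(a₄) ≥ k₄`, `ord_v(a₆) ≥ k₆`, `ord_v(Δ) = n`: the coefficients of `C • X` are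
polynomial, hence continuous, in `(u⁻¹, r, s, t)` (`polyVariableChange`), the six conditions are
open, and `K⁴` is dense in `K_v⁴` — the argument of
`LocalReduction.isMinimalAt_iff_isMinimal_integer_holds`.  Silverman, *AEC* VII.1 (Remark 1.1) and
*ATAEC* IV.9.4 (Tate's normal forms over `𝒪_v`). [cite: SilvermanAEC2009, VII.1 Remark 1.1]
[cite: SilvermanATAEC1994, IV.9.4] -/
theorem exists_variableChange_valuation_a_of_two [X.IsElliptic]
    (h2 : v.valuation K' (2 : K') = exp (-1 : ℤ)) {k₁ k₂ k₃ k₄ k₆ n : ℕ}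
    (hD : ∃ D : VariableChange (v.adicCompletionIntegers K'),
      (2 : v.adicCompletionIntegers K') ^ k₁ ∣ (D • X.localMinimalIntegralModel v).a₁ ∧
      (2 : v.adicCompletionIntegers K') ^ k₂ ∣ (D • X.localMinimalIntegralModel v).a₂ ∧
      (∃ γ : v.adicCompletionIntegers K', IsUnit γ ∧
        (D • X.localMinimalIntegralModel v).a₃ = 2 ^ k₃ * γ) ∧
      (2 : v.adicCompletionIntegers K') ^ k₄ ∣ (D • X.localMinimalIntegralModel v).a₄ ∧
      (2 : v.adicCompletionIntegers K') ^ k₆ ∣ (D • X.localMinimalIntegralModel v).a₆ ∧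
      (addVal (v.adicCompletionIntegers K') (D • X.localMinimalIntegralModel v).Δ).toNat = n) :
    X.ordMinimalDiscriminant v = n ∧
    ∃ C : VariableChange K',
      v.valuation K' (C • X).a₁ ≤ exp (-(k₁ : ℤ)) ∧ v.valuation K' (C • X).a₂ ≤ exp (-(k₂ : ℤ)) ∧
      v.valuation K' (C • X).a₃ = exp (-(k₃ : ℤ)) ∧ v.valuation K' (C • X).a₄ ≤ exp (-(k₄ : ℤ)) ∧
      v.valuation K' (C • X).a₆ ≤ exp (-(k₆ : ℤ)) ∧ v.valuation K' (C • X).Δ = exp (-(n : ℤ)) := by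
  set O := v.adicCompletionIntegers K' with hO
  set Kv := v.adicCompletion K' with hKv
  set φ := algebraMap K' Kv with hφ
  -- `2` is a uniformiser of `O`
  have h2v : Valued.v ((2 : O) : Kv) = exp (-1 : ℤ) := by
    have : ((2 : O) : Kv) = φ 2 := by rw [hφ, map_ofNat]; rfl
    rw [this, hφ, valued_algebraMap_adicCompletion, h2]
  have h2irr : Irreducible (2 : O) := irreducible_adicCompletionIntegers_of_valued_eq v 2 h2v
  set M := X.localMinimalIntegralModel v with hM
  obtain ⟨D, ha₁, ha₂, ⟨γ, hγ, ha₃⟩, ha₄, ha₆, hΔn⟩ := hD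
  set N := D • M with hN
  -- `ord_v(Δ_min) = n`
  have hΔM0 : M.Δ ≠ 0 := localMinimalIntegralModel_Δ_ne_zero v X
  have hΔN : N.Δ = ↑D.u⁻¹ ^ 12 * M.Δ := by rw [hN, variableChange_Δ]
  have hordN : addVal O N.Δ = addVal O M.Δ := by
    rw [hΔN, addVal_mul, addVal_pow, addVal_eq_zero_of_unit, nsmul_zero, zero_add]
  have hord : X.ordMinimalDiscriminant v = n := by
    rw [ordMinimalDiscriminant, ← hM, ← hordN, hΔn]
  refine ⟨hord, ?_⟩
  -- valuations of the coefficients of `N` in `K_v`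
  have hle : ∀ {x : O} {k : ℕ}, (2 : O) ^ k ∣ x → Valued.v (x : Kv) ≤ exp (-(k : ℤ)) := by
    rintro x k ⟨y, rfl⟩
    push_cast
    rw [Valuation.map_mul, Valuation.map_pow, h2v, ← exp_nsmul, nsmul_eq_mul, mul_neg, mul_one]
    exact mul_le_of_le_one_right' ((mem_adicCompletionIntegers _ _ _).mp y.2)
  have hN₁ : Valued.v (N.a₁ : Kv) ≤ exp (-(k₁ : ℤ)) := hle ha₁
  have hN₂ : Valued.v (N.a₂ : Kv) ≤ exp (-(k₂ : ℤ)) := hle ha₂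
  have hN₄ : Valued.v (N.a₄ : Kv) ≤ exp (-(k₄ : ℤ)) := hle ha₄
  have hN₆ : Valued.v (N.a₆ : Kv) ≤ exp (-(k₆ : ℤ)) := hle ha₆
  have hN₃ : Valued.v (N.a₃ : Kv) = exp (-(k₃ : ℤ)) := by
    rw [ha₃]
    push_cast
    rw [Valuation.map_mul, Valuation.map_pow, h2v, ← exp_nsmul, nsmul_eq_mul, mul_neg, mul_one,
      adicCompletionIntegers.isUnit_iff_valued_eq_one.mp hγ, mul_one]
  have hNΔ0 : N.Δ ≠ 0 := by
    rw [hΔN]; exact mul_ne_zero (pow_ne_zero _ (Units.ne_zero _)) hΔM0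
  have hNΔ : Valued.v (N.Δ : Kv) = exp (-(n : ℤ)) := by
    obtain ⟨m, u₀, hmu⟩ := eq_unit_mul_pow_irreducible hNΔ0 h2irr
    have hm : m = n := by
      have h := addVal_def N.Δ u₀ h2irr m hmu
      rw [← hΔn, h]; simp
    rw [hmu]
    push_cast
    rw [Valuation.map_mul, Valuation.map_pow, h2v, ← exp_nsmul, nsmul_eq_mul, mul_neg, mul_one,
      adicCompletionIntegers.isUnit_iff_valued_eq_one.mp (Units.isUnit u₀), one_mul, hm]
  -- the `K_v`-model `C • X_v = N`
  obtain ⟨C₀, hC₀⟩ : ∃ C₀ : VariableChange Kv, C₀ • X.baseChange Kv = X.localMinimalModel v :=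
    ⟨_, rfl⟩
  have hMK : M.map (algebraMap O Kv) = X.localMinimalModel v := by
    rw [hM, localMinimalIntegralModel]
    exact baseChange_integralModel_eq O (X.localMinimalModel v)
  set C : VariableChange Kv := D.map (algebraMap O Kv) * C₀ with hC
  set Xv := X.baseChange Kv with hXv
  have hNK : N.map (algebraMap O Kv) = C • Xv := by
    rw [hC, mul_smul, hXv, hC₀, ← hMK, hN, map_variableChange]
  have hC₁ : Valued.v (C • Xv).a₁ ≤ exp (-(k₁ : ℤ)) := by rw [← hNK, map_a₁]; exact hN₁
  have hC₂ : Valued.v (C • Xv).a₂ ≤ exp (-(k₂ : ℤ)) := by rw [← hNK, map_a₂]; exact hN₂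
  have hC₃ : Valued.v (C • Xv).a₃ = exp (-(k₃ : ℤ)) := by rw [← hNK, map_a₃]; exact hN₃
  have hC₄ : Valued.v (C • Xv).a₄ ≤ exp (-(k₄ : ℤ)) := by rw [← hNK, map_a₄]; exact hN₄
  have hC₆ : Valued.v (C • Xv).a₆ ≤ exp (-(k₆ : ℤ)) := by rw [← hNK, map_a₆]; exact hN₆
  have hCΔ : Valued.v (C • Xv).Δ = exp (-(n : ℤ)) := by rw [← hNK, map_Δ]; exact hNΔ
  -- approximation of `(u⁻¹, r, s, t)` by elements of `K`
  have hu0 : Valued.v (↑C.u⁻¹ : Kv) ≠ 0 := by simp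
  set S : Set (Kv × Kv × Kv × Kv) :=
    {p | Valued.v p.1 = Valued.v (↑C.u⁻¹ : Kv)} ∩
      ({p | Valued.v (Xv.polyVariableChange p).a₁ ≤ exp (-(k₁ : ℤ))} ∩
      {p | Valued.v (Xv.polyVariableChange p).a₂ ≤ exp (-(k₂ : ℤ))} ∩
      {p | Valued.v (Xv.polyVariableChange p).a₃ = exp (-(k₃ : ℤ))} ∩
      {p | Valued.v (Xv.polyVariableChange p).a₄ ≤ exp (-(k₄ : ℤ))} ∩
      {p | Valued.v (Xv.polyVariableChange p).a₆ ≤ exp (-(k₆ : ℤ))}) with hS_def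
  have hp₀ : C • Xv = Xv.polyVariableChange (↑C.u⁻¹, C.r, C.s, C.t) :=
    variableChange_eq_polyVariableChange Xv C
  have hS : S ∈ nhds ((↑C.u⁻¹ : Kv), C.r, C.s, C.t) := by
    refine Filter.inter_mem ?_ (Filter.inter_mem (Filter.inter_mem (Filter.inter_mem
      (Filter.inter_mem ?_ ?_) ?_) ?_) ?_)
    · exact continuous_fst.continuousAt.preimage_mem_nhds (Valued.locally_const hu0)
    · refine (Xv.continuous_polyVariableChange_a₁).continuousAt.preimage_mem_nhds
        (setOf_valued_le_exp_mem_nhds v _ ?_)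
      rw [← hp₀]; exact hC₁
    · refine (Xv.continuous_polyVariableChange_a₂).continuousAt.preimage_mem_nhds
        (setOf_valued_le_exp_mem_nhds v _ ?_)
      rw [← hp₀]; exact hC₂
    · have heq : Valued.v (Xv.polyVariableChange (↑C.u⁻¹, C.r, C.s, C.t)).a₃ = exp (-(k₃ : ℤ)) := by
        rw [← hp₀]; exact hC₃
      have hT := Valued.locally_const (x := (Xv.polyVariableChange (↑C.u⁻¹, C.r, C.s, C.t)).a₃)
        (by rw [heq]; exact exp_ne_zero)
      have h := (Xv.continuous_polyVariableChange_a₃).continuousAt.preimage_mem_nhds hT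
      simpa only [Set.preimage_setOf_eq, heq] using h
    · refine (Xv.continuous_polyVariableChange_a₄).continuousAt.preimage_mem_nhds
        (setOf_valued_le_exp_mem_nhds v _ ?_)
      rw [← hp₀]; exact hC₄
    · refine (Xv.continuous_polyVariableChange_a₆).continuousAt.preimage_mem_nhds
        (setOf_valued_le_exp_mem_nhds v _ ?_)
      rw [← hp₀]; exact hC₆
  have hd : DenseRange φ := HeightOneSpectrum.denseRange_algebraMap K' v
  obtain ⟨⟨w', r', s', t'⟩, hwv, ⟨⟨⟨⟨h₁, h₂⟩, h₃⟩, h₄⟩, h₆⟩⟩ :=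
    (hd.prodMap (hd.prodMap (hd.prodMap hd))).mem_nhds hS
  simp only [Prod.map_apply, Set.mem_setOf_eq] at hwv h₁ h₂ h₃ h₄ h₆
  have hw' : w' ≠ 0 := by
    rintro rfl
    rw [map_zero, Valuation.map_zero] at hwv
    exact hu0 hwv.symm
  set C' : VariableChange K' := ⟨(Units.mk0 w' hw')⁻¹, r', s', t'⟩ with hC'_def
  have hC'W : (C' • X).baseChange Kv = Xv.polyVariableChange (φ w', φ r', φ s', φ t') := by
    rw [variableChange_eq_polyVariableChange, baseChange, map_polyVariableChange]
    simp [C', hXv, hφ, baseChange]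
  have hval : ∀ x : K', v.valuation K' x = Valued.v (φ x) := fun x ↦ by
    rw [hφ, valued_algebraMap_adicCompletion]
  refine ⟨C', ?_, ?_, ?_, ?_, ?_, ?_⟩
  · rw [hval, show φ (C' • X).a₁ = ((C' • X).baseChange Kv).a₁ from rfl, hC'W]; exact h₁
  · rw [hval, show φ (C' • X).a₂ = ((C' • X).baseChange Kv).a₂ from rfl, hC'W]; exact h₂
  · rw [hval, show φ (C' • X).a₃ = ((C' • X).baseChange Kv).a₃ from rfl, hC'W]; exact h₃
  · rw [hval, show φ (C' • X).a₄ = ((C' • X).baseChange Kv).a₄ from rfl, hC'W]; exact h₄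
  · rw [hval, show φ (C' • X).a₆ = ((C' • X).baseChange Kv).a₆ from rfl, hC'W]; exact h₆
  · rw [hval, variableChange_Δ, inv_inv, Units.val_mk0, map_mul, map_pow, Valuation.map_mul,
      Valuation.map_pow, hwv, ← hCΔ, variableChange_Δ, Valuation.map_mul, Valuation.map_pow]
    simp only [hXv, baseChange, map_Δ]
    rfl

end Dedekind

/-! ## §3. Good reduction over a field containing a cube root of the uniformiser -/

section CubeRoot

variable {K : Type u} [Field K] [NumberField K] (X : WeierstrassCurve K)

/-- **Good reduction after adjoining a cube root of the uniformiser.**  Let `E/K` be given by a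
model `C • X` with `ord_v(a₁) ≥ k₁, ord_v(a₂) ≥ k₂, ord_v(a₃) ≥ k₃, ord_v(a₄) ≥ k₄, ord_v(a₆) ≥ k₆`,
`ord_v(Δ) = n` at a finite place `v`, where `ord_v(a) = 1`; let `L ⊇ K` be a number field
containing `β` with `β³ = a`, and `j ∈ ℕ` with `ij ≤ 3kᵢ` (`i = 1, 2, 3, 4, 6`) and `3n = 12j`.
Then `E` has good reduction at every place `w` of `L` above `v`: with `w(β) = ϖ^l`,
`w(a) = ϖ^e` (`e` the ramification index), `3l = e`; the substitution `(x, y) ↦ (β^{2j}x, β^{3j}y)`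
gives `ord_w(aᵢ β^{-ij}) ≥ e kᵢ - ijl = l(3kᵢ - ij) ≥ 0` and `ord_w(Δ β^{-12j}) = l(3n - 12j) = 0`,
an integral equation with unit discriminant (*AEC* VII.1 Remark 1.1, VII.5 Prop. 5.1(a):
`hasGoodReductionAt_of_valuation_le_one_of_valuation_Δ_eq_one`), and good reduction does not depend
on the equation (`hasGoodReductionAt_smul_iff_holds`).  This is the computation behind *ATAEC*
Table 4.1 / *AEC* VII.5.4 for the types `IV` (`j = 1`, `(kᵢ) = (1,1,1,2,2)`, `n = 4`) and `IV*`
(`j = 2`, `(kᵢ) = (1,2,2,3,4)`, `n = 8`) at an absolutely unramified place above `2`: such curves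
acquire good reduction over `K(∛2)`. [cite: SilvermanAEC2009, VII.1 Remark 1.1, VII.5 Prop. 5.1(a) and Prop. 5.4]
[cite: SilvermanATAEC1994, IV.9.4 Steps 5, 8 and Table 4.1] -/
theorem hasGoodReductionAt_baseChange_of_pow_three_eq (L : Type*) [Field L] [NumberField L]
    [Algebra K L] {v : HeightOneSpectrum (𝓞 K)} {a : K}
    (ha : v.valuation K a = exp (-1 : ℤ)) {β : L} (hβ : β ^ 3 = algebraMap K L a) (j : ℕ)
    {k₁ k₂ k₃ k₄ k₆ n : ℕ} (C : VariableChange K)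
    (h₁ : v.valuation K (C • X).a₁ ≤ exp (-(k₁ : ℤ))) (h₂ : v.valuation K (C • X).a₂ ≤ exp (-(k₂ : ℤ)))
    (h₃ : v.valuation K (C • X).a₃ ≤ exp (-(k₃ : ℤ))) (h₄ : v.valuation K (C • X).a₄ ≤ exp (-(k₄ : ℤ)))
    (h₆ : v.valuation K (C • X).a₆ ≤ exp (-(k₆ : ℤ))) (hΔ : v.valuation K (C • X).Δ = exp (-(n : ℤ)))
    (hk₁ : j ≤ 3 * k₁) (hk₂ : 2 * j ≤ 3 * k₂) (hk₃ : 3 * j ≤ 3 * k₃) (hk₄ : 4 * j ≤ 3 * k₄)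
    (hk₆ : 6 * j ≤ 3 * k₆) (hn : 3 * n = 12 * j)
    {w : HeightOneSpectrum (𝓞 L)} (hw : w.asIdeal.under (𝓞 K) = v.asIdeal) :
    (X.baseChange L).HasGoodReductionAt w := by
  haveI : w.asIdeal.LiesOver v.asIdeal := ⟨hw.symm⟩
  set e := v.asIdeal.ramificationIdx' w.asIdeal with he
  have hval : ∀ x : K, w.valuation L (algebraMap K L x) = (v.valuation K x) ^ e :=
    fun x ↦ (valuation_liesOver L v w x).symm
  have ha0 : a ≠ 0 := by
    rintro rfl
    rw [Valuation.map_zero] at ha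
    exact exp_ne_zero ha.symm
  have hβ0 : β ≠ 0 := by
    rintro rfl
    rw [zero_pow three_ne_zero, eq_comm, map_eq_zero_iff _ (algebraMap K L).injective] at hβ
    exact ha0 hβ
  -- `w(β) = exp l` with `3 l = -e`
  have hwβ0 : w.valuation L β ≠ 0 := by rwa [Valuation.ne_zero_iff]
  set l : ℤ := log (w.valuation L β) with hl
  have hwβ : w.valuation L β = exp l := (exp_log hwβ0).symm
  have h3l : 3 * l = -(e : ℤ) := by
    have h := congrArg (w.valuation L) hβ
    rw [Valuation.map_pow, hwβ, ← exp_nsmul, hval, ha, ← exp_nsmul] at h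
    simpa using exp_injective h
  have hl0 : l ≤ 0 := by omega
  -- the rescaled model over `L`
  set u : Lˣ := Units.mk0 (β ^ j) (pow_ne_zero _ hβ0) with hu
  set CL : VariableChange L := ⟨u, 0, 0, 0⟩ with hCL
  set Y : WeierstrassCurve L := CL • ((C • X).baseChange L) with hY
  have hYeq : Y = (CL * (C.map (algebraMap K L))) • (X.baseChange L) := by
    rw [hY, mul_smul, baseChange, ← map_variableChange]; rfl
  have hwu : ∀ i : ℕ, w.valuation L ((↑u⁻¹ : L) ^ i) = exp (-((i * j : ℕ) : ℤ) * l) := by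
    intro i
    rw [Units.val_inv_eq_inv_val, hu, Units.val_mk0, Valuation.map_pow, map_inv₀, Valuation.map_pow,
      hwβ, ← exp_nsmul, ← exp_neg, ← exp_nsmul]
    congr 1
    push_cast
    ring
  have he3 : (e : ℤ) = -(3 * l) := by omega
  have hcoef : ∀ {x : K} {k i : ℕ}, v.valuation K x ≤ exp (-(k : ℤ)) → i * j ≤ 3 * k →
      w.valuation L ((↑u⁻¹ : L) ^ i * algebraMap K L x) ≤ 1 := by
    intro x k i hx hik
    rw [Valuation.map_mul, hwu, hval]
    have hx' : v.valuation K x ^ e ≤ exp (-(k : ℤ)) ^ e := pow_le_pow_left' hx e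
    refine (mul_le_mul' le_rfl hx').trans ?_
    rw [← exp_nsmul, ← exp_add, ← exp_zero, exp_le_exp]
    simp only [nsmul_eq_mul]
    rw [he3]
    push_cast
    have hik' : (i : ℤ) * j ≤ 3 * k := by exact_mod_cast hik
    have hprod : l * (3 * (k : ℤ) - i * j) ≤ 0 := mul_nonpos_of_nonpos_of_nonneg hl0 (by linarith)
    linarith
  have hY₁ : w.valuation L Y.a₁ ≤ 1 := by
    have : Y.a₁ = (↑u⁻¹ : L) ^ 1 * algebraMap K L (C • X).a₁ := by
      rw [hY, hCL, variableChange_a₁]; simp [baseChange]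
    rw [this]; exact hcoef h₁ (by omega)
  have hY₂ : w.valuation L Y.a₂ ≤ 1 := by
    have : Y.a₂ = (↑u⁻¹ : L) ^ 2 * algebraMap K L (C • X).a₂ := by
      rw [hY, hCL, variableChange_a₂]; simp [baseChange]
    rw [this]; exact hcoef h₂ (by omega)
  have hY₃ : w.valuation L Y.a₃ ≤ 1 := by
    have : Y.a₃ = (↑u⁻¹ : L) ^ 3 * algebraMap K L (C • X).a₃ := by
      rw [hY, hCL, variableChange_a₃]; simp [baseChange]
    rw [this]; exact hcoef h₃ (by omega)
  have hY₄ : w.valuation L Y.a₄ ≤ 1 := by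
    have : Y.a₄ = (↑u⁻¹ : L) ^ 4 * algebraMap K L (C • X).a₄ := by
      rw [hY, hCL, variableChange_a₄]; simp [baseChange]
    rw [this]; exact hcoef h₄ (by omega)
  have hY₆ : w.valuation L Y.a₆ ≤ 1 := by
    have : Y.a₆ = (↑u⁻¹ : L) ^ 6 * algebraMap K L (C • X).a₆ := by
      rw [hY, hCL, variableChange_a₆]; simp [baseChange]
    rw [this]; exact hcoef h₆ (by omega)
  have hYΔ : w.valuation L Y.Δ = 1 := by
    have : Y.Δ = (↑u⁻¹ : L) ^ 12 * algebraMap K L (C • X).Δ := by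
      rw [hY, variableChange_Δ, baseChange, map_Δ]
    rw [this, Valuation.map_mul, hwu, hval, hΔ, ← exp_nsmul, ← exp_add, ← exp_zero]
    congr 1
    simp only [nsmul_eq_mul]
    rw [he3]
    push_cast
    have hn' : (3 : ℤ) * n = 12 * j := by exact_mod_cast hn
    have hln : l * (3 * (n : ℤ)) = l * (12 * j) := by rw [hn']
    linarith
  have hgood := hasGoodReductionAt_of_valuation_le_one_of_valuation_Δ_eq_one w Y hY₁ hY₂ hY₃ hY₄ hY₆ hYΔ
  rw [hYeq] at hgood
  exact (hasGoodReductionAt_smul_iff_holds w (X.baseChange L) _).mp hgood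

end CubeRoot

/-! ## §4. Over `ℚ`: the types `IV` and `IV*` at `2` -/

section Rat

variable (W : WeierstrassCurve ℚ)

/-- At a place `v ∋ 2` of `ℚ`, `ord_v(2) = 1`. [folklore] -/
theorem Rat.valuation_two_of_two_mem {v : HeightOneSpectrum (𝓞 ℚ)} (hv : (2 : 𝓞 ℚ) ∈ v.asIdeal) :
    v.valuation ℚ (2 : ℚ) = exp (-1 : ℤ) := by
  have h := Rat.valuation_natGenerator v
  rwa [Rat.natGenerator_eq_two hv, Nat.cast_ofNat] at h

/-- **Type `IV` at `2` over `ℚ`: `ord₂ Δ_min = 4` and a `ℚ`-model with `ord₂(a₁, a₂) ≥ 1`,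
`ord₂(a₃) = 1`, `ord₂(a₄, a₆) ≥ 2`, `ord₂(Δ) = 4`** (*ATAEC* IV.9.4 Step 5 with `π = 2`, made
`ℚ`-rational). [cite: SilvermanATAEC1994, IV.9.4 Step 5 and Table 4.1] -/
theorem ordMinimalDiscriminant_eq_of_kodairaSymbolAt_IV_two [W.IsElliptic]
    {v : HeightOneSpectrum (𝓞 ℚ)} (hv : (2 : 𝓞 ℚ) ∈ v.asIdeal) (hT : W.kodairaSymbolAt v = .IV) :
    W.ordMinimalDiscriminant v = 4 ∧
    ∃ C : VariableChange ℚ,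
      v.valuation ℚ (C • W).a₁ ≤ exp (-(1 : ℕ) : ℤ) ∧ v.valuation ℚ (C • W).a₂ ≤ exp (-(1 : ℕ) : ℤ) ∧
      v.valuation ℚ (C • W).a₃ = exp (-(1 : ℕ) : ℤ) ∧ v.valuation ℚ (C • W).a₄ ≤ exp (-(2 : ℕ) : ℤ) ∧
      v.valuation ℚ (C • W).a₆ ≤ exp (-(2 : ℕ) : ℤ) ∧ v.valuation ℚ (C • W).Δ = exp (-(4 : ℕ) : ℤ) := by
  have h2 := Rat.valuation_two_of_two_mem hv
  have h2irr := irreducible_two_adicCompletionIntegers v h2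
  rw [kodairaSymbolAt_def] at hT
  obtain ⟨D, h₁, h₂, ⟨γ, hγ, h₃⟩, h₄, h₆, hΔ⟩ :=
    LocalIndex.exists_smul_a_of_kodairaSymbolOfMinimal_eq_IV_of_two h2irr _ hT
  exact W.exists_variableChange_valuation_a_of_two v h2
    ⟨D, by simpa using h₁, by simpa using h₂, ⟨γ, hγ, by simpa using h₃⟩, h₄, h₆, hΔ⟩

/-- **Type `IV*` at `2` over `ℚ`: `ord₂ Δ_min = 8` and a `ℚ`-model with `ord₂(a₁) ≥ 1`,
`ord₂(a₂) ≥ 2`, `ord₂(a₃) = 2`, `ord₂(a₄) ≥ 3`, `ord₂(a₆) ≥ 4`, `ord₂(Δ) = 8`** (*ATAEC* IV.9.4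
Step 8 with `π = 2`, made `ℚ`-rational). [cite: SilvermanATAEC1994, IV.9.4 Step 8 and Table 4.1] -/
theorem ordMinimalDiscriminant_eq_of_kodairaSymbolAt_IVstar_two [W.IsElliptic]
    {v : HeightOneSpectrum (𝓞 ℚ)} (hv : (2 : 𝓞 ℚ) ∈ v.asIdeal)
    (hT : W.kodairaSymbolAt v = .IVstar) :
    W.ordMinimalDiscriminant v = 8 ∧
    ∃ C : VariableChange ℚ,
      v.valuation ℚ (C • W).a₁ ≤ exp (-(1 : ℕ) : ℤ) ∧ v.valuation ℚ (C • W).a₂ ≤ exp (-(2 : ℕ) : ℤ) ∧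
      v.valuation ℚ (C • W).a₃ = exp (-(2 : ℕ) : ℤ) ∧ v.valuation ℚ (C • W).a₄ ≤ exp (-(3 : ℕ) : ℤ) ∧
      v.valuation ℚ (C • W).a₆ ≤ exp (-(4 : ℕ) : ℤ) ∧ v.valuation ℚ (C • W).Δ = exp (-(8 : ℕ) : ℤ) := by
  have h2 := Rat.valuation_two_of_two_mem hv
  have h2irr := irreducible_two_adicCompletionIntegers v h2
  rw [kodairaSymbolAt_def] at hT
  obtain ⟨D, h₁, h₂, ⟨γ, hγ, h₃⟩, h₄, h₆, hΔ⟩ :=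
    LocalIndex.exists_smul_a_of_kodairaSymbolOfMinimal_eq_IVstar_of_two h2irr _ hT
  exact W.exists_variableChange_valuation_a_of_two v h2
    ⟨D, by simpa using h₁, h₂, ⟨γ, hγ, h₃⟩, h₄, h₆, hΔ⟩

/-- **`δ₂ = 0` for the types `IV`, `IV*` at `2` over `ℚ`**: `δ_v = ord_v(Δ_min) - (m_v + 1)`
(`wildConductorExponent_eq_of_kodairaSymbolAt_wild`: `f_v = ord_v Δ_min + 1 - m_v` by the tree's
definition of the conductor exponent through Ogg's formula, `ε_v = 2`, `m_v = 3, 7`) and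
`ord₂ Δ_min = 4, 8`.  Silverman, *ATAEC*, Table 4.1 and IV.11.1.
[cite: SilvermanATAEC1994, IV.9 Table 4.1 and Thm. IV.11.1] -/
theorem wildConductorExponent_eq_zero_of_kodairaSymbolAt_IV_or_IVstar_two [W.IsElliptic]
    {v : HeightOneSpectrum (𝓞 ℚ)} (hv : (2 : 𝓞 ℚ) ∈ v.asIdeal)
    (hT : W.kodairaSymbolAt v = .IV ∨ W.kodairaSymbolAt v = .IVstar) :
    W.wildConductorExponent v = 0 := by
  rcases hT with hT | hT
  · rw [W.wildConductorExponent_eq_of_kodairaSymbolAt_wild v (Or.inr (Or.inl ⟨hT, rfl⟩)),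
      (W.ordMinimalDiscriminant_eq_of_kodairaSymbolAt_IV_two hv hT).1]
  · rw [W.wildConductorExponent_eq_of_kodairaSymbolAt_wild v (Or.inr (Or.inr (Or.inl ⟨hT, rfl⟩))),
      (W.ordMinimalDiscriminant_eq_of_kodairaSymbolAt_IVstar_two hv hT).1]

/-- **A curve of type `IV` or `IV*` at `2` over `ℚ` acquires good reduction over any number field
containing a cube root of `2`** (at every place above `2`): the `ℚ`-models of
`ordMinimalDiscriminant_eq_of_kodairaSymbolAt_IV_two / _IVstar_two` rescaled by `u = β`, resp.
`u = β²` (`hasGoodReductionAt_baseChange_of_pow_three_eq`).  So the inertia group acts on `E[ℓ]`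
through the tame quotient `Gal(ℚ₂^{nr}(∛2)/ℚ₂^{nr}) ≅ C₃` (*AEC* VII.5.4; *ATAEC* proof of
Thm. IV.10.2(b)).  [cite: SilvermanAEC2009, VII.5 Prop. 5.4] [cite: SilvermanATAEC1994, IV.9.4 Steps 5, 8; proof of Thm. IV.10.2(b) (PDF pp. 359–361)] -/
theorem hasGoodReductionAt_baseChange_of_kodairaSymbolAt_IV_or_IVstar_two [W.IsElliptic]
    {v : HeightOneSpectrum (𝓞 ℚ)} (hv : (2 : 𝓞 ℚ) ∈ v.asIdeal)
    (hT : W.kodairaSymbolAt v = .IV ∨ W.kodairaSymbolAt v = .IVstar)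
    (L : Type*) [Field L] [NumberField L] [Algebra ℚ L] {β : L} (hβ : β ^ 3 = 2)
    {w : HeightOneSpectrum (𝓞 L)} (hw : w.asIdeal.under (𝓞 ℚ) = v.asIdeal) :
    (W.baseChange L).HasGoodReductionAt w := by
  have h2 := Rat.valuation_two_of_two_mem hv
  have hβ' : β ^ 3 = algebraMap ℚ L 2 := by rw [hβ, map_ofNat]
  rcases hT with hT | hT
  · obtain ⟨-, C, h₁, h₂, h₃, h₄, h₆, hΔ⟩ := W.ordMinimalDiscriminant_eq_of_kodairaSymbolAt_IV_two hv hT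
    exact W.hasGoodReductionAt_baseChange_of_pow_three_eq L h2 hβ' 1 C h₁ h₂ h₃.le h₄ h₆ hΔ
      (by norm_num) (by norm_num) (by norm_num) (by norm_num) (by norm_num) (by norm_num) hw
  · obtain ⟨-, C, h₁, h₂, h₃, h₄, h₆, hΔ⟩ :=
      W.ordMinimalDiscriminant_eq_of_kodairaSymbolAt_IVstar_two hv hT
    exact W.hasGoodReductionAt_baseChange_of_pow_three_eq L h2 hβ' 2 C h₁ h₂ h₃.le h₄ h₆ hΔ
      (by norm_num) (by norm_num) (by norm_num) (by norm_num) (by norm_num) (by norm_num) hw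

/-- **The wild ramification groups above `2` fix `E[ℓ]` for a curve of type `IV` or `IV*` at `2`
over `ℚ`** (`ℓ` a prime other than `2`, `𝔓 ∣ 2`, `u > 0`).  Take `β ∈ ℚ̄` with `β³ = 2` and
`L = ℚ(β) ⊆ ℚ̄`.  Every `σ ∈ Γ_ℚ^u(𝔓)` fixes the cube roots of `2`
(`smul_eq_of_mem_absUpperRamificationSubgroup_of_pow_three_eq`), hence fixes `e(L) = ℚ(e(β))`
pointwise for the embedding `e : L → ℚ̄` of `exists_mem_range_absGaloisRestrict_iff` (`L = ℚ[β]`),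
i.e. lies in the image of `Γ_L`; it also lies in `I_𝔓`; and `E` has good reduction at the places
of `L` above `2` (`hasGoodReductionAt_baseChange_of_kodairaSymbolAt_IV_or_IVstar_two`), so `σ`
fixes the `ℓ`-torsion (*AEC* VII.4.1(a) over `L`,
`smul_eq_of_mem_inertia_of_baseChange_of_nsmul_eq_zero`).  In the language of *ATAEC* §IV.10:
`ℚ₂(E[ℓ])/ℚ₂` is tamely ramified, `δ(E/ℚ₂) = 0`.
[cite: SilvermanATAEC1994, §IV.10 Definition of δ (PDF p. 358) and proof of Thm. IV.10.2(b) (pp. 359–361)]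
[cite: SilvermanAEC2009, Prop. VII.4.1(a)] [cite: SerreLocalFields1979, Ch. IV §2 Cor. 1–3 of Prop. 7] -/
theorem forall_smul_geomTorsion_eq_of_kodairaSymbolAt_IV_or_IVstar_two [W.IsElliptic]
    {v : HeightOneSpectrum (𝓞 ℚ)} (hv : (2 : 𝓞 ℚ) ∈ v.asIdeal)
    (hT : W.kodairaSymbolAt v = .IV ∨ W.kodairaSymbolAt v = .IVstar)
    {ℓ : ℕ} (hℓ : (ℓ : 𝓞 ℚ) ∉ v.asIdeal)
    {𝔓 : Ideal (absIntegers (𝓞 ℚ) ℚ)} (h𝔓 : 𝔓 ∈ v.primesAbove) {u : ℝ} (hu : 0 < u) :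
    ∀ σ ∈ absUpperRamificationSubgroup (𝓞 ℚ) 𝔓 u, ∀ T : geomTorsion W ℓ, σ • T = T := by
  intro σ hσ T
  -- `β ∈ ℚ̄` with `β³ = 2`, and `L = ℚ(β)`
  obtain ⟨β, hβ⟩ : ∃ β : AlgebraicClosure ℚ, β ^ 3 = algebraMap ℚ (AlgebraicClosure ℚ) 2 :=
    IsAlgClosed.exists_pow_nat_eq _ three_pos
  have hβint : _root_.IsIntegral ℚ β := ⟨X ^ 3 - C 2, monic_X_pow_sub_C _ three_ne_zero, by simp [hβ]⟩
  set L : IntermediateField ℚ (AlgebraicClosure ℚ) := ℚ⟮β⟯ with hL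
  haveI : FiniteDimensional ℚ L := IntermediateField.adjoin.finiteDimensional hβint
  haveI : NumberField L := NumberField.of_module_finite ℚ L
  set βL : L := ⟨β, IntermediateField.mem_adjoin_simple_self ℚ β⟩ with hβL_def
  have hβL : βL ^ 3 = 2 := by
    apply Subtype.ext
    simp only [hβL_def, SubmonoidClass.mk_pow, hβ]
    exact (map_ofNat (algebraMap L (AlgebraicClosure ℚ)) 2).symm
  -- good reduction over `L` above `v`
  have hgood : ∀ w : HeightOneSpectrum (𝓞 L), w.asIdeal.under (𝓞 ℚ) = v.asIdeal →
      (W.baseChange L).HasGoodReductionAt w := fun w hw ↦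
    W.hasGoodReductionAt_baseChange_of_kodairaSymbolAt_IV_or_IVstar_two hv hT L hβL hw
  -- `σ` lies in the image of `Γ_L`: it fixes `e(L) = ℚ(e β)`
  obtain ⟨e, he⟩ := exists_mem_range_absGaloisRestrict_iff ℚ L
  have heβ : (e βL) ^ 3 = algebraMap ℚ (AlgebraicClosure ℚ) 2 := by
    rw [← map_pow, hβL, map_ofNat, map_ofNat]
  have hσe : σ • e βL = e βL :=
    smul_eq_of_mem_absUpperRamificationSubgroup_of_pow_three_eq hv h𝔓 hu hσ two_ne_zero heβ
  have hσL : σ ∈ (absGaloisRestrict ℚ L).range := by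
    rw [he]
    intro x
    have hx : (x : AlgebraicClosure ℚ) ∈ (ℚ⟮β⟯).toSubalgebra := x.2
    rw [IntermediateField.adjoin_simple_toSubalgebra_of_isAlgebraic hβint.isAlgebraic,
      Algebra.adjoin_singleton_eq_range_aeval] at hx
    obtain ⟨p, hp⟩ := hx
    have hx' : x = aeval βL p := by
      apply Subtype.ext
      have h1 : ((aeval βL p : L) : AlgebraicClosure ℚ) = aeval β p :=
        (aeval_algHom_apply (IntermediateField.val L) βL p).symm
      rw [h1]
      exact hp.symm
    -- `e x = p(e β)` and `σ(p(e β)) = p(σ e β)` (ring homomorphisms out of `ℚ` are unique)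
    have h1 : e (aeval βL p) = p.eval₂ (algebraMap ℚ (AlgebraicClosure ℚ)) (e βL) := by
      rw [aeval_def]
      have h := hom_eval₂ p (algebraMap ℚ L) (e : L →+* AlgebraicClosure ℚ) βL
      rw [RingHom.ext_rat ((e : L →+* AlgebraicClosure ℚ).comp (algebraMap ℚ L))
        (algebraMap ℚ (AlgebraicClosure ℚ))] at h
      exact h
    set τ : AlgebraicClosure ℚ →+* AlgebraicClosure ℚ :=
      ((absoluteGaloisGroup.toAlgEquiv ℚ σ : AlgebraicClosure ℚ ≃ₐ[ℚ] AlgebraicClosure ℚ) :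
        AlgebraicClosure ℚ →+* AlgebraicClosure ℚ) with hτ
    have hτapp : ∀ y : AlgebraicClosure ℚ, σ • y = τ y := fun y ↦ by
      rw [absoluteGaloisGroup.smul_def, hτ]; rfl
    have h2 := hom_eval₂ p (algebraMap ℚ (AlgebraicClosure ℚ)) τ (e βL)
    rw [RingHom.ext_rat (τ.comp (algebraMap ℚ (AlgebraicClosure ℚ)))
      (algebraMap ℚ (AlgebraicClosure ℚ)), ← hτapp, ← hτapp, hσe] at h2
    rw [hx', h1, h2]
  -- `σ ∈ I_𝔓` fixes the `ℓ`-torsion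
  have hσI : σ ∈ 𝔓.inertia (absoluteGaloisGroup ℚ) :=
    absUpperRamificationSubgroup_le_inertia_holds (𝓞 ℚ) 𝔓 u hσ
  have hT0 : ℓ • (T : geomPoints W) = 0 := by
    have := (W.mem_geomTorsion_iff ℓ (T : geomPoints W)).mp T.2
    rwa [natCast_zsmul] at this
  exact Subtype.ext (W.smul_eq_of_mem_inertia_of_baseChange_of_nsmul_eq_zero L hgood hℓ h𝔓 hσI hσL hT0)

variable (ℓ : ℕ) [Fact ℓ.Prime]

/-- **`Sw_𝔓(V_ℓ E) = 0` for the types `IV`, `IV*` at `2` over `ℚ`** (`ℓ ≠ 2`, `𝔓 ∣ 2`): the wild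
ramification groups fix `E[ℓ]` (`forall_smul_geomTorsion_eq_of_kodairaSymbolAt_IV_or_IVstar_two`),
so `Sw_𝔓(V_ℓ E) = 2 · vol ∅ = 0` (`swanConductorAt_rationalTate_eq_zero_of_forall_smul_geomTorsion_eq`,
Serre–Tate §3).  Silverman, *ATAEC*, Table 4.1 (`f = 2` for `IV`, `IV*`) with Thm. IV.10.2(b).
[cite: SilvermanATAEC1994, IV.9 Table 4.1, Thm. IV.10.2(b) (PDF pp. 358–361)] [cite: SerreTate1968, §3] -/
theorem swanConductorAt_rationalTate_eq_zero_of_kodairaSymbolAt_IV_or_IVstar_two [W.IsElliptic]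
    (h : Continuous fun x : absoluteGaloisGroup ℚ × RationalTateModule (geomPoints W) ℓ ↦
      rationalTateRepresentation (absoluteGaloisGroup ℚ) (geomPoints W) ℓ x.1 x.2)
    {v : HeightOneSpectrum (𝓞 ℚ)} (hv : (2 : 𝓞 ℚ) ∈ v.asIdeal)
    (hT : W.kodairaSymbolAt v = .IV ∨ W.kodairaSymbolAt v = .IVstar) (hℓ : (ℓ : 𝓞 ℚ) ∉ v.asIdeal)
    {𝔓 : Ideal (absIntegers (𝓞 ℚ) ℚ)} (h𝔓 : 𝔓 ∈ v.primesAbove) :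
    (rationalTateGaloisRepOf (geomPoints W) ℓ h).swanConductorAt (𝓞 ℚ) 𝔓 = 0 :=
  W.swanConductorAt_rationalTate_eq_zero_of_forall_smul_geomTorsion_eq ℓ h hℓ h𝔓
    fun _ hu ↦ W.forall_smul_geomTorsion_eq_of_kodairaSymbolAt_IV_or_IVstar_two hv hT hℓ h𝔓 hu

/-- **Ogg's formula at `2` for the types `IV`, `IV*` over `ℚ`, `ℓ`-adic form**: at a place `v ∋ 2`
of type `IV` or `IV*`, `Sw_𝔓(V_ℓ E) = δ_v(E)` for every prime `ℓ ≠ 2` and every `𝔓 ∣ v` — both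
sides vanish.  Silverman, *ATAEC*, Thm. IV.11.1 (the case `p = 2`, p. 366, referred to Saito) for
these two rows of Table 4.1. [cite: SilvermanATAEC1994, Thm. IV.11.1 (PDF pp. 365–366) and Table 4.1]
[cite: Saito1988, Theorem 1] -/
theorem swanConductorAt_rationalTate_eq_wildConductorExponent_of_kodairaSymbolAt_IV_or_IVstar_two
    [W.IsElliptic]
    (h : Continuous fun x : absoluteGaloisGroup ℚ × RationalTateModule (geomPoints W) ℓ ↦
      rationalTateRepresentation (absoluteGaloisGroup ℚ) (geomPoints W) ℓ x.1 x.2)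
    {v : HeightOneSpectrum (𝓞 ℚ)} (hv : (2 : 𝓞 ℚ) ∈ v.asIdeal)
    (hT : W.kodairaSymbolAt v = .IV ∨ W.kodairaSymbolAt v = .IVstar) (hℓ : (ℓ : 𝓞 ℚ) ∉ v.asIdeal)
    {𝔓 : Ideal (absIntegers (𝓞 ℚ) ℚ)} (h𝔓 : 𝔓 ∈ v.primesAbove) :
    (rationalTateGaloisRepOf (geomPoints W) ℓ h).swanConductorAt (𝓞 ℚ) 𝔓 =
      (W.wildConductorExponent v : ℝ) := by
  rw [W.swanConductorAt_rationalTate_eq_zero_of_kodairaSymbolAt_IV_or_IVstar_two ℓ h hv hT hℓ h𝔓,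
    W.wildConductorExponent_eq_zero_of_kodairaSymbolAt_IV_or_IVstar_two hv hT, Nat.cast_zero]

attribute [local instance] AddSubgroup.torsionBy.zmodModule in
/-- **Ogg's formula at `2` for the types `IV`, `IV*` over `ℚ`, `3`-torsion form** — the shape of
the hypothesis `H` of `conductorNatOf_geomPoints_eq_conductorNorm_of_isElliptic_of_potentiallyGood`
and its siblings: at a place `v ∋ 2` of type `IV` or `IV*`, `Sw_𝔓(E[3]) = δ_v(E)` (`= 0`) for every
`𝔓 ∣ v` (`Sw_𝔓(V₃ E) = Sw_𝔓(E[3])`, `swanConductorAt_rationalTate_eq_swanConductorAt_torsion`).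
[cite: SilvermanATAEC1994, §IV.10 Definition of δ(E/K) (PDF p. 358), Thm. IV.11.1 (pp. 365–366), Table 4.1]
[cite: Saito1988, Theorem 1] -/
theorem swanConductorAt_torsion_eq_wildConductorExponent_of_kodairaSymbolAt_IV_or_IVstar_two
    [W.IsElliptic] {v : HeightOneSpectrum (𝓞 ℚ)} (hv : (2 : 𝓞 ℚ) ∈ v.asIdeal)
    (hT : W.kodairaSymbolAt v = .IV ∨ W.kodairaSymbolAt v = .IVstar)
    {𝔓 : Ideal (absIntegers (𝓞 ℚ) ℚ)} (h𝔓 : 𝔓 ∈ v.primesAbove) :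
    (W.torsionGaloisRep 3).swanConductorAt (𝓞 ℚ) 𝔓 = (W.wildConductorExponent v : ℝ) := by
  haveI : Fact (Nat.Prime 3) := ⟨Nat.prime_three⟩
  have h3 : ((3 : ℕ) : 𝓞 ℚ) ∉ v.asIdeal := by
    intro h3
    apply (Ideal.ne_top_iff_one v.asIdeal).mp v.isPrime.ne_top
    have := v.asIdeal.sub_mem h3 hv
    rwa [show ((3 : ℕ) : 𝓞 ℚ) - 2 = 1 by norm_num] at this
  rw [← W.swanConductorAt_rationalTate_eq_swanConductorAt_torsion 3
    (W.continuous_rationalGaloisRepTate_holds 3) h3 h𝔓]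
  exact W.swanConductorAt_rationalTate_eq_wildConductorExponent_of_kodairaSymbolAt_IV_or_IVstar_two 3
    _ hv hT h3 h𝔓

/-- `2` lies in the place `v₂ = primesEquiv.symm 2` of `ℚ`. [folklore] -/
theorem Rat.two_mem_primesEquiv_symm_two :
    (2 : 𝓞 ℚ) ∈ ((Rat.HeightOneSpectrum.primesEquiv (R := 𝓞 ℚ)).symm ⟨2, Nat.prime_two⟩).asIdeal := by
  have := (natCast_mem_asIdeal_iff_eq_primesEquiv_symm
    ((Rat.HeightOneSpectrum.primesEquiv (R := 𝓞 ℚ)).symm ⟨2, Nat.prime_two⟩) Nat.prime_two).mpr rfl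
  simpa using this

/-- **The C15 fact `N^{(ℓ)}(V_ℓ E) = N_E` for every `W / ℚ` of Kodaira type `IV` or `IV*` at `2`,
every prime `ℓ`, unconditionally**: the hypothesis `H` of
`conductorNatOf_geomPoints_eq_conductorNorm_of_isElliptic_of_potentiallyGood` holds for such `W`
(`swanConductorAt_torsion_eq_wildConductorExponent_of_kodairaSymbolAt_IV_or_IVstar_two` at any prime
above `2`, `primesAbove_nonempty`).  Serre–Tate 1968 §3 with Silverman *ATAEC* §IV.10–11.
[cite: SerreTate1968, §3] [cite: SilvermanATAEC1994, §IV.10 Definition of the conductor (PDF p. 364), Thm. IV.11.1 (pp. 365–366)] -/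
theorem conductorNatOf_geomPoints_eq_conductorNorm_of_isElliptic_of_kodairaSymbolAt_IV_or_IVstar_two
    (hT : ∀ [W.IsElliptic],
      W.kodairaSymbolAt ((Rat.HeightOneSpectrum.primesEquiv (R := 𝓞 ℚ)).symm ⟨2, Nat.prime_two⟩) = .IV ∨
      W.kodairaSymbolAt ((Rat.HeightOneSpectrum.primesEquiv (R := 𝓞 ℚ)).symm ⟨2, Nat.prime_two⟩) =
        .IVstar) :
    W.conductorNatOf_geomPoints_eq_conductorNorm_of_isElliptic ℓ := by
  refine W.conductorNatOf_geomPoints_eq_conductorNorm_of_isElliptic_of_potentiallyGood ℓ ?_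
  intro _ _ _
  obtain ⟨𝔓, h𝔓⟩ := HeightOneSpectrum.primesAbove_nonempty
    ((Rat.HeightOneSpectrum.primesEquiv (R := 𝓞 ℚ)).symm ⟨2, Nat.prime_two⟩)
  exact ⟨𝔓, h𝔓, W.swanConductorAt_torsion_eq_wildConductorExponent_of_kodairaSymbolAt_IV_or_IVstar_two
    Rat.two_mem_primesEquiv_symm_two hT h𝔓⟩

/-- **`a_p(V_ℓ E) = f_p(E)` at every `p ≠ ℓ`, every prime `ℓ`, for every `W / ℚ` of Kodaira type
`IV` or `IV*` at `2`** (the corrected exponent fact of `HasseWeilAbelian` at `K = ℚ`, via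
`artinConductorExponent_tate_eq_conductorExponent_of_isElliptic_of_potentiallyGood`).
[cite: SerreTate1968, §3] [cite: SilvermanATAEC1994, §IV.10 Definition of ε, δ, f (PDF p. 358), Thm. IV.11.1 (pp. 365–366)] -/
theorem artinConductorExponent_tate_eq_conductorExponent_of_isElliptic_of_kodairaSymbolAt_IV_or_IVstar_two
    (hT : ∀ [W.IsElliptic],
      W.kodairaSymbolAt ((Rat.HeightOneSpectrum.primesEquiv (R := 𝓞 ℚ)).symm ⟨2, Nat.prime_two⟩) = .IV ∨
      W.kodairaSymbolAt ((Rat.HeightOneSpectrum.primesEquiv (R := 𝓞 ℚ)).symm ⟨2, Nat.prime_two⟩) =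
        .IVstar) :
    W.artinConductorExponent_tate_eq_conductorExponent_of_isElliptic ℓ := by
  refine W.artinConductorExponent_tate_eq_conductorExponent_of_isElliptic_of_potentiallyGood ℓ ?_
  intro _ _ _
  obtain ⟨𝔓, h𝔓⟩ := HeightOneSpectrum.primesAbove_nonempty
    ((Rat.HeightOneSpectrum.primesEquiv (R := 𝓞 ℚ)).symm ⟨2, Nat.prime_two⟩)
  exact ⟨𝔓, h𝔓, W.swanConductorAt_torsion_eq_wildConductorExponent_of_kodairaSymbolAt_IV_or_IVstar_two
    Rat.two_mem_primesEquiv_symm_two hT h𝔓⟩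

end Rat

end WeierstrassCurve

/-! ### bsd.S15 and the ideal form for the types `IV`, `IV*` at `2` -/

namespace Literature.NumberTheory.EllipticCurves

open _root_.WeierstrassCurve Literature.NumberTheory.GaloisRepresentations
  Literature.NumberTheory.DiophantineGeometry

variable (W : WeierstrassCurve ℚ) (ℓ : ℕ) [Fact ℓ.Prime]

/-- **bsd.S15, corrected numerical form `N_E = N^{(ℓ)}(V_ℓ E)`, for every `W / ℚ` of Kodaira type
`IV` or `IV*` at `2` and every prime `ℓ`** (via
`conductorNorm_eq_artinConductorNat_of_isElliptic_of_potentiallyGood`).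
[cite: SerreTate1968, §3] [cite: SilvermanATAEC1994, §IV.10 Definition of the conductor (PDF p. 364), Thm. IV.11.1 (pp. 365–366)] -/
theorem conductorNorm_eq_artinConductorNat_of_isElliptic_of_kodairaSymbolAt_IV_or_IVstar_two
    (hT : ∀ [W.IsElliptic],
      W.kodairaSymbolAt ((Rat.HeightOneSpectrum.primesEquiv (R := 𝓞 ℚ)).symm ⟨2, Nat.prime_two⟩) = .IV ∨
      W.kodairaSymbolAt ((Rat.HeightOneSpectrum.primesEquiv (R := 𝓞 ℚ)).symm ⟨2, Nat.prime_two⟩) =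
        .IVstar) :
    conductorNorm_eq_artinConductorNat_of_isElliptic W ℓ := by
  refine conductorNorm_eq_artinConductorNat_of_isElliptic_of_potentiallyGood W ℓ ?_
  intro _ _ _
  obtain ⟨𝔓, h𝔓⟩ := HeightOneSpectrum.primesAbove_nonempty
    ((Rat.HeightOneSpectrum.primesEquiv (R := 𝓞 ℚ)).symm ⟨2, Nat.prime_two⟩)
  exact ⟨𝔓, h𝔓, W.swanConductorAt_torsion_eq_wildConductorExponent_of_kodairaSymbolAt_IV_or_IVstar_two
    Rat.two_mem_primesEquiv_symm_two hT h𝔓⟩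

/-- **bsd.S15 (d), corrected ideal form `𝔣(E/ℚ) = 𝔣^{(ℓ)}(V_ℓ E) · (ℓ)^{f_ℓ}`, for every `W / ℚ` of
Kodaira type `IV` or `IV*` at `2` and every prime `ℓ`** (via
`conductor_eq_conductorOf_mul_of_isElliptic_of_potentiallyGood`, `BSDConductorIsEllipticPotGoodTwoProofs`).
[cite: SerreTate1968, §3] [cite: SilvermanATAEC1994, §IV.10 Definition of 𝔣(E/K) (PDF p. 364), Thm. IV.11.1 (pp. 365–366)] -/
theorem conductor_eq_conductorOf_mul_of_isElliptic_of_kodairaSymbolAt_IV_or_IVstar_two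
    (hT : ∀ [W.IsElliptic],
      W.kodairaSymbolAt ((Rat.HeightOneSpectrum.primesEquiv (R := 𝓞 ℚ)).symm ⟨2, Nat.prime_two⟩) = .IV ∨
      W.kodairaSymbolAt ((Rat.HeightOneSpectrum.primesEquiv (R := 𝓞 ℚ)).symm ⟨2, Nat.prime_two⟩) =
        .IVstar) :
    conductor_eq_conductorOf_mul_of_isElliptic W ℓ := by
  refine conductor_eq_conductorOf_mul_of_isElliptic_of_potentiallyGood W ℓ ?_
  intro _ _ _
  obtain ⟨𝔓, h𝔓⟩ := HeightOneSpectrum.primesAbove_nonempty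
    ((Rat.HeightOneSpectrum.primesEquiv (R := 𝓞 ℚ)).symm ⟨2, Nat.prime_two⟩)
  exact ⟨𝔓, h𝔓, W.swanConductorAt_torsion_eq_wildConductorExponent_of_kodairaSymbolAt_IV_or_IVstar_two
    Rat.two_mem_primesEquiv_symm_two hT h𝔓⟩

end Literature.NumberTheory.EllipticCurves

end
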